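import Mathlib
import Summits.CriticalPhenomena.Ising3DConformalLimit.Theorems.GaussianScaleMixtureCriticalTwoPointGSMDiagSpectralRepresentation
import Summits.CriticalPhenomena.Ising3DConformalLimit.Theorems.GaussianScaleMixtureCriticalTwoPointGSMJsTrigSum
import Summits.CriticalPhenomena.Ising3DConformalLimit.Theorems.GaussianScaleMixtureCriticalTwoPointGSMJsPairCountTendsto
import Summits.CriticalPhenomena.Ising3DConformalLimit.Theorems.GaussianScaleMixtureCriticalTwoPointGSMJsCompactness
import Summits.CriticalPhenomena.Ising3DConformalLimit.Theorems.GaussianScaleMixtureCriticalTwoPointGSMDiagCesaroIdentity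
import Summits.CriticalPhenomena.Ising3DConformalLimit.Theorems.GaussianScaleMixtureCriticalTwoPointGSMDiagApproximants

/-!
# The diagonal (swap-mirror) JOINT Källén–Lehmann measure of the critical two-point function of the 3D
Ising model (route `GaussianScaleMixture`, crux `CriticalTwoPointGSM`, line `Sketch`, canonical-lift
spine — nine-direction dividend; registered stub `diagJointSpectralMeasure`)

Sequel of `…GSMDiagSpectralRepresentation.lean`: with the plane site `ι(z) = z₀(e₀+e₁) + z₁e₂` of the
swap-mirror plane `{x₀ = x₁}` and the normal step `u = e₀ - e₁`, there is a probability measure `ρ_d` on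
`[0,1] × [-π,π]²` with `⟨σ₀ σ_{ι(z) + n u}⟩⁺_{β_c} = ∫ λ^{|n|} cos(k·z) dρ_d` for all `n ∈ ℤ`, `z ∈ ℤ²` —
unconditional: closed nine-mirror reflection positivity + the Hankel → Hausdorff moment theorem
(`diagSpectralRepresentation`) + Bochner in the in-plane momentum by the discrete-momentum Cesàro/DFT
construction (`js_trigSum`, `diag_cesaroIdentity`, `diag_approximants`, `js_pairCount_tendsto`,
`js_compactness`). This is the axial `jointSpectralMeasure` transported to a diagonal mirror WITHOUT a
transfer matrix — the "nine-direction spectral envelope" infrastructure of the line.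

References: J. Fröhlich, R. Israel, E. H. Lieb, B. Simon, Comm. Math. Phys. 62 (1978) §3 Thm. 3.1;
C. Berg, J. P. R. Christensen, P. Ressel, *Harmonic Analysis on Semigroups* (1984) Ch. 4;
M. Aizenman, H. Duminil-Copin, Ann. of Math. 194 (2021) Prop. 5.3.
-/

namespace Summit.CriticalPhenomena.Ising3DConformalLimit.Theorems

open MeasureTheory Filter Topology
open Literature.Probability.LatticeModels
open scoped BigOperators

noncomputable section

/-- **The diagonal joint Källén–Lehmann measure (registered stub `diagJointSpectralMeasure`),
unconditional.** There is a probability measure `ρ` on `ℝ³` carried by `[0,1] × [-π,π]²` with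
`⟨σ₀ σ_{(z₀+n, z₀-n, z₁)}⟩⁺_{β_c} = ∫ λ^{|n|} cos(k₁z₀ + k₂z₁) dρ(λ,k)` for every `n ∈ ℤ` and
`z ∈ ℤ²` — the transfer-matrix-free spectral representation of the critical 3D Ising two-point
function with respect to the swap mirror `x₀ = x₁` (normal step `u = e₀ - e₁`, in-plane lattice
`ι(z) = z₀(e₀+e₁) + z₁e₂`), jointly in the normal and in-plane variables: closed nine-mirror
reflection positivity + the Hankel → Hausdorff moment theorem (`diagSpectralRepresentation`) +
Bochner in the in-plane momentum by the discrete-momentum Cesàro/DFT construction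
(`js_trigSum`, `diag_cesaroIdentity`, `diag_approximants`, `js_pairCount_tendsto`,
`js_compactness`). -/
theorem diagJointSpectralMeasure :
    ∃ ρ : Measure (Fin 3 → ℝ), IsProbabilityMeasure ρ ∧
      ρ {p | 0 ≤ p 0 ∧ p 0 ≤ 1 ∧ ∀ j : Fin 2, -Real.pi ≤ p j.succ ∧ p j.succ ≤ Real.pi}ᶜ = 0 ∧
      ∀ (n : ℤ) (z : Fin 2 → ℤ),
        criticalTwoPoint 3 (z 0 • (Pi.single 0 1 + Pi.single 1 1) + z 1 • Pi.single 2 1 +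
            n • (Pi.single 0 1 - Pi.single 1 1)) =
          ∫ p, (p 0) ^ n.natAbs * Real.cos (∑ j : Fin 2, p j.succ * (z j : ℝ)) ∂ρ := by
  -- the diagonal two-point data as a function of `(n, z)`
  let Gd : ℤ → (Fin 2 → ℤ) → ℝ := fun n z =>
    criticalTwoPoint 3 (z 0 • (Pi.single 0 1 + Pi.single 1 1) + z 1 • Pi.single 2 1 +
      n • (Pi.single 0 1 - Pi.single 1 1))
  have happ := diag_approximants (diag_cesaroIdentity js_trigSum) diagSpectralRepresentation
  -- choose the approximants (junk below `N = 0`, never used in the limit)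
  have hex : ∀ N : ℕ, ∃ ρ : Measure (Fin 3 → ℝ), IsProbabilityMeasure ρ ∧
      ρ {p | 0 ≤ p 0 ∧ p 0 ≤ 1 ∧ ∀ j : Fin 2, -Real.pi ≤ p j.succ ∧ p j.succ ≤ Real.pi}ᶜ = 0 ∧
      (1 ≤ N → ∀ (n : ℤ) (z : Fin 2 → ℤ), (∀ i : Fin 2, |z i| < N) →
        ∫ p, (p 0) ^ n.natAbs * Real.cos (∑ j : Fin 2, p j.succ * (z j : ℝ)) ∂ρ =
          ((((Fintype.piFinset (fun _ : Fin 2 => Finset.Ico (0 : ℤ) N)) ×ˢ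
              (Fintype.piFinset (fun _ : Fin 2 => Finset.Ico (0 : ℤ) N))).filter
              (fun xy => xy.1 - xy.2 = z)).card : ℝ) / (N : ℝ) ^ 2 * Gd n z) := by
    intro N
    rcases Nat.eq_zero_or_pos N with h0 | hpos
    · obtain ⟨ρ, hP, hsupp, -⟩ := happ 1 le_rfl
      exact ⟨ρ, hP, hsupp, fun h => by omega⟩
    · obtain ⟨ρ, hP, hsupp, hmom⟩ := happ N hpos
      exact ⟨ρ, hP, hsupp, fun _ => hmom⟩
  choose ρs hP hsupp hmom using hex
  -- the joint moments of the approximants converge to `Gd n z`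
  have hlim : ∀ (n : ℤ) (z : Fin 2 → ℤ), Tendsto (fun N =>
      ∫ p, (p 0) ^ n.natAbs * Real.cos (∑ j : Fin 2, p j.succ * (z j : ℝ)) ∂(ρs N)) atTop
      (𝓝 (Gd n z)) := by
    intro n z
    have hw := (js_pairCount_tendsto z).mul_const (Gd n z)
    rw [one_mul] at hw
    refine hw.congr' ?_
    obtain ⟨M, hM⟩ : ∃ M : ℕ, ∀ i : Fin 2, (z i).natAbs < M := by
      refine ⟨(Finset.univ.sup fun i => (z i).natAbs) + 1, fun i => ?_⟩
      have : (z i).natAbs ≤ Finset.univ.sup fun i => (z i).natAbs :=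
        Finset.le_sup (f := fun i => (z i).natAbs) (Finset.mem_univ i)
      omega
    rw [EventuallyEq, eventually_atTop]
    refine ⟨M + 1, fun N hN => ?_⟩
    have hzN : ∀ i : Fin 2, |z i| < N := fun i => by
      rw [← Int.natCast_natAbs]
      have := hM i
      exact_mod_cast (by omega : (z i).natAbs < N)
    exact (hmom N (by omega) n z hzN).symm
  obtain ⟨ρ, hPρ, hsuppρ, hmomρ⟩ := js_compactness ρs Gd hP hsupp hlim
  exact ⟨ρ, hPρ, hsuppρ, fun n z => (hmomρ n z).symm⟩

end

end Summit.CriticalPhenomena.Ising3DConformalLimit.Theorems
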